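import Literature.Analysis.FluidPDE.KatoBilinearEstimates
import Literature.Analysis.FluidPDE.KochTataruPointwise
import Literature.Analysis.FluidPDE.KochTataruFixedPoint
import Literature.Analysis.FunctionSpaces.MinkowskiIntegral
import HarnessLib

/-!
# Kato's weighted estimates for the bilinear Duhamel operator `B(u, v) = ∫₀ᵗ e^{(t-s)Δ}ℙ∇·(u ⊗ v) ds`

Analysis/FluidPDE support file, second layer of the unit-viscosity discharge of Kato's weighted
local existence theorem in `L³(ℝ³)` (`kato_local_L3_unit`, `KatoLocalL3Scaling.lean`, whence
`kato_local_L3`, `MildL3Smooth.lean`; Kato 1984, Thm. 1; Lemarié-Rieusset 2016, Thm. 7.5). With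
the tree's physical-space bilinear operator `B(u, v) = kochTataruBilinear u v`
(`KochTataru.lean`: `B(u,v)(t,x) = ∫_{(0,t)} ∫ K(t-s, x-y)[u(s,y), v(s,y)] dy ds`, `K` the
Oseen–Koch–Tataru kernel of `e^{τΔ}ℙ∇·`, viscosity `1`) and the `Lᵖ → L^q` slice bounds of
`OseenKernelLp.lean`, this file proves the three estimates of Kato's iteration in the weighted
class `sup_s s^{1/4}‖u(s)‖₆ < ∞`, `sup_s s^{1/2}‖u(s)‖_∞ < ∞` on a time window `(0, T)`
(Kato 1984, (2.3)–(2.5); Lemarié-Rieusset 2016, proof of Thm. 7.5, PDF pp. 156–157, `q = 6`,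
`β = 1/4`: `‖B(F,G)‖_q ≤ C ∫₀ᵗ (t-s)^{-(1-β)} s^{-2β} ds ‖F‖‖G‖ = C' t^{-β} ‖F‖‖G‖` and
`‖B(F,G)‖₃ ≤ C ∫₀ᵗ (t-s)^{-(1-2β)} s^{-2β} ds ‖F‖‖G‖`), in dimension three:

* `KatoL3.exists_eLpNorm_kochTataruBilinear_le`: if `‖|u(s)||v(s)|‖_{L³} ≤ m s^{-1/2}` on
  `(0,T)` then `‖B(u,v)(t)‖_{L³} ≤ K m` and `‖B(u,v)(t)‖_{L⁶} ≤ K m t^{-1/4}` for `t ∈ (0, T]`;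
* `KatoL3.exists_norm_kochTataruBilinear_le`: if `‖|u(s)||v(s)|‖_{L⁶} ≤ m s^{-3/4}` on `(0,T)` then
  `‖B(u,v)(t,x)‖ ≤ K m t^{-1/2}` for **every** `x`, together with the absolute convergence of the
  defining space–time integral at every `(t, x)` (the hypothesis of the bilinearity lemmas
  `kochTataruBilinear_sub_left/right_apply` of `KochTataruFixedPoint.lean`);
* the product bounds feeding these hypotheses from Kato's weights
  (`KatoL3.eLpNorm_norm_mul_norm_three_le`, `…_six_le_of_left/right`), the elementary time
  integrals `∫₀ᵗ (t-s)^{-α} s^{-β} ds ≤ 2(1/(1-α) + 1/(1-β)) t^{1-α-β}`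
  (`KatoL3.lintegral_Ioo_rpow_mul_rpow_le`), and the joint measurability of the slices needed for
  Minkowski's integral inequality (`KatoL3.stronglyMeasurable_slice_prod`).

The `L³`/`L⁶` bounds are Minkowski's integral inequality
(`Literature.Analysis.FunctionSpaces.eLpNorm_integral_le_lintegral_eLpNorm`) applied to
`B(t) = ∫_{(0,t)} T_{t-s}[u(s), v(s)] ds` with the slice bounds; the pointwise bound is Hölder on
the kernel majorant. Everything is proved; no definitions besides the grouping namespace `KatoL3`.

## Mathlib / tree search

Tree: `kochTataruBilinear`, `oseenKernel`, `exists_norm_oseenKernel_le`, `measurable_oseenKernel`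
(`KochTataru*.lean`); the slice bounds `eLpNorm_oseenSlice_le_same`, `exists_eLpNorm_oseenSlice_le`,
`enorm_oseenSlice_le_eLpNorm_mul`, `enorm_oseenSlice_le_lintegral`, `exists_eLpNorm_oseenEnvelope_le`,
`eLpNorm_norm_mul_norm_le` (`OseenKernelLp.lean`); the Hölder triples and the general-`ν`
`oseenDuhamel` versions of these bounds in `KatoBilinearEstimates.lean` (this file is the
`kochTataruBilinear`, unit-viscosity API with absolute convergence in the form consumed by
`KochTataruFixedPoint.lean`); Minkowski (`MinkowskiIntegral.lean`);
`setLIntegral_Ioo_rpow_neg_half` (`KochTataruPointwise.lean`, the case `1/2`). `OseenHeatLpBounds.lean`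
gives the analogous bounds for the heat-flow realisation `oseenHeat` of bounded matrix fields, a
different object. Mathlib: `integral_rpow`, `intervalIntegral.intervalIntegrable_rpow'`,
`StronglyMeasurable.integral_prod_right`, `lintegral_prod`, `eLpNorm_smul_le_mul_eLpNorm`.

## References

* T. Kato, *Strong `Lᵖ`-solutions of the Navier–Stokes equation in `ℝᵐ`, with applications to
  weak solutions*, Math. Z. 187 (1984) 471–480, §2, (2.3)–(2.5). [Kato1984]
* P. G. Lemarié-Rieusset, *The Navier–Stokes Problem in the 21st Century*, CRC Press 2016,
  doi:10.1201/b19556, Thm. 7.5 and its proof (PDF pp. 155–158). [LemarieRieusset2016]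
-/

noncomputable section

open MeasureTheory TopologicalSpace Set Function Filter
open _root_.Topology
open scoped ENNReal NNReal RealInnerProductSpace

namespace Literature.Analysis.FluidPDE

namespace KatoL3

variable {E : Type*} [NormedAddCommGroup E] [InnerProductSpace ℝ E] [FiniteDimensional ℝ E]
  [MeasurableSpace E] [BorelSpace E]

/-! ### Product bounds -/

/-- **Products of two `L⁶` fields in Kato's class**: if `‖u‖₆ ≤ a₁ s^{-1/4}` and
`‖v‖₆ ≤ a₂ s^{-1/4}` then `‖|u||v|‖₃ ≤ a₁ a₂ s^{-1/2}` (Hölder `6, 6 → 3`). [folklore] -/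
theorem eLpNorm_norm_mul_norm_three_le {u v : E → E} (hu : AEStronglyMeasurable u volume)
    (hv : AEStronglyMeasurable v volume) {a₁ a₂ s : ℝ} (ha₁ : 0 ≤ a₁) (hs : 0 < s)
    (hu6 : eLpNorm u 6 volume ≤ ENNReal.ofReal (a₁ * s ^ (-(1 / 4 : ℝ))))
    (hv6 : eLpNorm v 6 volume ≤ ENNReal.ofReal (a₂ * s ^ (-(1 / 4 : ℝ)))) :
    eLpNorm (fun y => ‖u y‖ * ‖v y‖) 3 volume ≤ ENNReal.ofReal (a₁ * a₂ * s ^ (-(1 / 2 : ℝ))) := by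
  haveI := holderTriple_six_six_three
  refine (eLpNorm_norm_mul_norm_le hu hv 6 6 3).trans ?_
  refine (mul_le_mul' hu6 hv6).trans (le_of_eq ?_)
  rw [← ENNReal.ofReal_mul (by positivity)]
  congr 1
  have : s ^ (-(1 / 4 : ℝ)) * s ^ (-(1 / 4 : ℝ)) = s ^ (-(1 / 2 : ℝ)) := by
    rw [← Real.rpow_add hs]; norm_num
  calc a₁ * s ^ (-(1 / 4 : ℝ)) * (a₂ * s ^ (-(1 / 4 : ℝ)))
      = a₁ * a₂ * (s ^ (-(1 / 4 : ℝ)) * s ^ (-(1 / 4 : ℝ))) := by ring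
    _ = a₁ * a₂ * s ^ (-(1 / 2 : ℝ)) := by rw [this]

/-- **Products `L⁶ × L^∞` in Kato's class**: if `‖u‖₆ ≤ a s^{-1/4}` and `‖v(y)‖ ≤ b s^{-1/2}` for
all `y` then `‖|u||v|‖₆ ≤ a b s^{-3/4}`. [folklore] -/
theorem eLpNorm_norm_mul_norm_six_le_of_right {u v : E → E} (hu : AEStronglyMeasurable u volume)
    (hv : AEStronglyMeasurable v volume) {a b s : ℝ} (ha : 0 ≤ a) (hs : 0 < s)
    (hu6 : eLpNorm u 6 volume ≤ ENNReal.ofReal (a * s ^ (-(1 / 4 : ℝ))))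
    (hvb : ∀ y, ‖v y‖ ≤ b * s ^ (-(1 / 2 : ℝ))) :
    eLpNorm (fun y => ‖u y‖ * ‖v y‖) 6 volume ≤ ENNReal.ofReal (a * b * s ^ (-(3 / 4 : ℝ))) := by
  have hv' : eLpNorm v ∞ volume ≤ ENNReal.ofReal (b * s ^ (-(1 / 2 : ℝ))) := by
    rw [eLpNorm_exponent_top]
    exact eLpNormEssSup_le_of_ae_bound (Eventually.of_forall hvb)
  refine (eLpNorm_norm_mul_norm_le hu hv 6 ∞ 6).trans ?_
  refine (mul_le_mul' hu6 hv').trans (le_of_eq ?_)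
  rw [← ENNReal.ofReal_mul (by positivity)]
  congr 1
  have : s ^ (-(1 / 4 : ℝ)) * s ^ (-(1 / 2 : ℝ)) = s ^ (-(3 / 4 : ℝ)) := by
    rw [← Real.rpow_add hs]; norm_num
  calc a * s ^ (-(1 / 4 : ℝ)) * (b * s ^ (-(1 / 2 : ℝ)))
      = a * b * (s ^ (-(1 / 4 : ℝ)) * s ^ (-(1 / 2 : ℝ))) := by ring
    _ = a * b * s ^ (-(3 / 4 : ℝ)) := by rw [this]

/-- **Products `L^∞ × L⁶` in Kato's class**: if `‖u(y)‖ ≤ b s^{-1/2}` for all `y` and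
`‖v‖₆ ≤ a s^{-1/4}` then `‖|u||v|‖₆ ≤ b a s^{-3/4}`. [folklore] -/
theorem eLpNorm_norm_mul_norm_six_le_of_left {u v : E → E} (hu : AEStronglyMeasurable u volume)
    (hv : AEStronglyMeasurable v volume) {a b s : ℝ} (ha : 0 ≤ a) (hs : 0 < s)
    (hu' : ∀ y, ‖u y‖ ≤ b * s ^ (-(1 / 2 : ℝ)))
    (hv6 : eLpNorm v 6 volume ≤ ENNReal.ofReal (a * s ^ (-(1 / 4 : ℝ)))) :
    eLpNorm (fun y => ‖u y‖ * ‖v y‖) 6 volume ≤ ENNReal.ofReal (b * a * s ^ (-(3 / 4 : ℝ))) := by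
  have h := eLpNorm_norm_mul_norm_six_le_of_right hv hu ha hs hv6 hu'
  have heq : (fun y => ‖u y‖ * ‖v y‖) = fun y => ‖v y‖ * ‖u y‖ := funext fun y => mul_comm _ _
  rw [heq, mul_comm b a]
  exact h

/-! ### The elementary time integrals -/

/-- **The Beta-type time integrals of Kato's iteration, bounded elementarily**: for
`0 ≤ α < 1`, `0 ≤ β < 1` and `t > 0`,
`∫_{(0,t)} (t - s)^{-α} s^{-β} ds ≤ 2 (1/(1-α) + 1/(1-β)) t^{1-α-β}` (in `ℝ≥0∞`; split at `t/2`
and bound one factor on each half: `∫₀^{t/2} ≤ (t/2)^{-α} (t/2)^{1-β}/(1-β)`,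
`∫_{t/2}^t ≤ (t/2)^{-β} (t/2)^{1-α}/(1-α)`, and `(t/2)^{1-α-β} ≤ 2 t^{1-α-β}`). [folklore] -/
theorem lintegral_Ioo_rpow_mul_rpow_le {α β : ℝ} (hα0 : 0 ≤ α) (hα : α < 1) (hβ0 : 0 ≤ β)
    (hβ : β < 1) {t : ℝ} (ht : 0 < t) :
    ∫⁻ s in Ioo 0 t, ENNReal.ofReal ((t - s) ^ (-α) * s ^ (-β)) ≤
      ENNReal.ofReal (2 * (1 / (1 - α) + 1 / (1 - β)) * t ^ (1 - α - β)) := by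
  have ht2 : 0 < t / 2 := half_pos ht
  have h1α : 0 < 1 - α := sub_pos.2 hα
  have h1β : 0 < 1 - β := sub_pos.2 hβ
  -- single-power integrals
  have hI : ∀ {γ : ℝ}, 0 ≤ γ → γ < 1 → ∀ {c : ℝ}, 0 < c →
      ∫⁻ s in Ioo 0 c, ENNReal.ofReal (s ^ (-γ)) = ENNReal.ofReal (c ^ (1 - γ) / (1 - γ)) := by
    intro γ hγ0 hγ c hc
    have hr : (-1 : ℝ) < -γ := by linarith
    have hint : IntegrableOn (fun σ : ℝ => σ ^ (-γ)) (Ioo 0 c) := by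
      have h := (intervalIntegral.intervalIntegrable_rpow' hr (a := 0) (b := c))
      rw [intervalIntegrable_iff_integrableOn_Ioo_of_le hc.le] at h
      exact h
    rw [← ofReal_integral_eq_lintegral_ofReal hint]
    · congr 1
      rw [← integral_Ioc_eq_integral_Ioo, ← intervalIntegral.integral_of_le hc.le,
        integral_rpow (Or.inl hr), Real.zero_rpow (by linarith), sub_zero]
      congr 1 <;> ring
    · refine (ae_restrict_iff' measurableSet_Ioo).2 (Eventually.of_forall fun σ hσ => ?_)
      exact Real.rpow_nonneg hσ.1.le _
  -- reflected single-power integral on `(t/2, t)`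
  have hI' : ∫⁻ s in Ioo (t / 2) t, ENNReal.ofReal ((t - s) ^ (-α)) =
      ENNReal.ofReal ((t / 2) ^ (1 - α) / (1 - α)) := by
    have hmp : MeasurePreserving (fun s : ℝ => t - s) volume volume :=
      Measure.measurePreserving_sub_left volume t
    have hemb : MeasurableEmbedding (fun s : ℝ => t - s) :=
      (MeasurableEquiv.subLeft t).measurableEmbedding
    have h := hmp.setLIntegral_comp_preimage_emb hemb
      (fun σ => ENNReal.ofReal (σ ^ (-α))) (Ioo 0 (t / 2))
    rw [preimage_const_sub_Ioo, sub_zero, show t - t / 2 = t / 2 by ring] at h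
    rw [h, hI hα0 hα ht2]
  -- split at `t/2`
  have hsplit : Ioo 0 t ⊆ Ioo 0 (t / 2) ∪ Ioo (t / 2) t ∪ {t / 2} := by
    intro s hs
    rcases lt_trichotomy s (t / 2) with h | h | h
    · exact Or.inl (Or.inl ⟨hs.1, h⟩)
    · exact Or.inr h
    · exact Or.inl (Or.inr ⟨h, hs.2⟩)
  have hmono := lintegral_mono_set (μ := (volume : Measure ℝ))
    (f := fun s => ENNReal.ofReal ((t - s) ^ (-α) * s ^ (-β))) hsplit
  refine hmono.trans ?_
  refine (lintegral_union_le _ _ _).trans ?_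
  rw [lintegral_singleton, Real.volume_singleton, mul_zero, add_zero]
  refine (lintegral_union_le _ _ _).trans ?_
  -- first half: `(t - s)^{-α} ≤ (t/2)^{-α}`
  have h1 : ∫⁻ s in Ioo 0 (t / 2), ENNReal.ofReal ((t - s) ^ (-α) * s ^ (-β)) ≤
      ENNReal.ofReal ((t / 2) ^ (-α) * ((t / 2) ^ (1 - β) / (1 - β))) := by
    calc ∫⁻ s in Ioo 0 (t / 2), ENNReal.ofReal ((t - s) ^ (-α) * s ^ (-β))
        ≤ ∫⁻ s in Ioo 0 (t / 2), ENNReal.ofReal ((t / 2) ^ (-α)) * ENNReal.ofReal (s ^ (-β)) := by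
          refine setLIntegral_mono' measurableSet_Ioo fun s hs => ?_
          rw [← ENNReal.ofReal_mul (Real.rpow_nonneg ht2.le _)]
          refine ENNReal.ofReal_le_ofReal (mul_le_mul_of_nonneg_right ?_ (Real.rpow_nonneg hs.1.le _))
          exact Real.rpow_le_rpow_of_nonpos ht2 (by linarith [hs.2]) (by linarith)
      _ = ENNReal.ofReal ((t / 2) ^ (-α)) * ENNReal.ofReal ((t / 2) ^ (1 - β) / (1 - β)) := by
          rw [lintegral_const_mul' _ _ ENNReal.ofReal_ne_top, hI hβ0 hβ ht2]
      _ = _ := by rw [← ENNReal.ofReal_mul (Real.rpow_nonneg ht2.le _)]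
  -- second half: `s^{-β} ≤ (t/2)^{-β}`
  have h2 : ∫⁻ s in Ioo (t / 2) t, ENNReal.ofReal ((t - s) ^ (-α) * s ^ (-β)) ≤
      ENNReal.ofReal ((t / 2) ^ (-β) * ((t / 2) ^ (1 - α) / (1 - α))) := by
    calc ∫⁻ s in Ioo (t / 2) t, ENNReal.ofReal ((t - s) ^ (-α) * s ^ (-β))
        ≤ ∫⁻ s in Ioo (t / 2) t, ENNReal.ofReal ((t / 2) ^ (-β)) * ENNReal.ofReal ((t - s) ^ (-α)) := by
          refine setLIntegral_mono' measurableSet_Ioo fun s hs => ?_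
          rw [← ENNReal.ofReal_mul (Real.rpow_nonneg ht2.le _), mul_comm ((t / 2) ^ (-β))]
          refine ENNReal.ofReal_le_ofReal (mul_le_mul_of_nonneg_left ?_
            (Real.rpow_nonneg (by linarith [hs.2]) _))
          exact Real.rpow_le_rpow_of_nonpos ht2 hs.1.le (by linarith)
      _ = ENNReal.ofReal ((t / 2) ^ (-β)) * ENNReal.ofReal ((t / 2) ^ (1 - α) / (1 - α)) := by
          rw [lintegral_const_mul' _ _ ENNReal.ofReal_ne_top, hI']
      _ = _ := by rw [← ENNReal.ofReal_mul (Real.rpow_nonneg ht2.le _)]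
  refine (add_le_add h1 h2).trans ?_
  rw [← ENNReal.ofReal_add (by positivity) (by positivity)]
  refine ENNReal.ofReal_le_ofReal ?_
  -- real arithmetic: both terms are `(t/2)^{1-α-β}/(1-·)` and `(t/2)^{1-α-β} ≤ 2 t^{1-α-β}`
  have hpow1 : (t / 2) ^ (-α) * (t / 2) ^ (1 - β) = (t / 2) ^ (1 - α - β) := by
    rw [← Real.rpow_add ht2]; congr 1; ring
  have hpow2 : (t / 2) ^ (-β) * (t / 2) ^ (1 - α) = (t / 2) ^ (1 - α - β) := by
    rw [← Real.rpow_add ht2]; congr 1; ring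
  have hhalf : (t / 2) ^ (1 - α - β) ≤ 2 * t ^ (1 - α - β) := by
    rw [Real.div_rpow ht.le zero_le_two]
    rw [div_le_iff₀ (Real.rpow_pos_of_pos two_pos _)]
    have h2pow : (1 : ℝ) ≤ 2 * (2 : ℝ) ^ (1 - α - β) := by
      have : (2 : ℝ) ^ (1 - α - β) ≥ 2 ^ (-1 : ℝ) :=
        Real.rpow_le_rpow_of_exponent_le one_le_two (by linarith)
      rw [Real.rpow_neg_one] at this
      linarith
    have htpos : 0 ≤ t ^ (1 - α - β) := Real.rpow_nonneg ht.le _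
    nlinarith
  calc (t / 2) ^ (-α) * ((t / 2) ^ (1 - β) / (1 - β)) + (t / 2) ^ (-β) * ((t / 2) ^ (1 - α) / (1 - α))
      = (t / 2) ^ (1 - α - β) * (1 / (1 - α) + 1 / (1 - β)) := by
        rw [mul_div_assoc', hpow1, mul_div_assoc', hpow2]
        field_simp
        ring
    _ ≤ 2 * t ^ (1 - α - β) * (1 / (1 - α) + 1 / (1 - β)) :=
        mul_le_mul_of_nonneg_right hhalf (by positivity)
    _ = 2 * (1 / (1 - α) + 1 / (1 - β)) * t ^ (1 - α - β) := by ring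

/-! ### Joint measurability of the slices -/

/-- **Joint measurability of the Duhamel slices** `(x, s) ↦ ∫ K(t - s, x - y)[u(s,y), v(s,y)] dy`
on `E × ℝ` for jointly strongly measurable `u`, `v` (Fubini measurability of the measurable kernel
`measurable_oseenKernel`), the hypothesis of Minkowski's integral inequality. [folklore] -/
theorem stronglyMeasurable_slice_prod {u v : ℝ → E → E} (hu : StronglyMeasurable (uncurry u))
    (hv : StronglyMeasurable (uncurry v)) (t : ℝ) :
    StronglyMeasurable (uncurry fun (x : E) (s : ℝ) =>
      ∫ y, oseenKernel (t - s) (x - y) (u s y) (v s y)) := by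
  have hF : Measurable (fun z : (E × ℝ) × E =>
      oseenKernel (t - z.1.2) (z.1.1 - z.2) (u z.1.2 z.2) (v z.1.2 z.2)) := by
    refine Measurable.oseenKernel_comp (by fun_prop) (by fun_prop) ?_ ?_
    · exact hu.measurable.comp (measurable_fst.snd.prodMk measurable_snd)
    · exact hv.measurable.comp (measurable_fst.snd.prodMk measurable_snd)
  exact StronglyMeasurable.integral_prod_right (f := fun (p : E × ℝ) (y : E) =>
    oseenKernel (t - p.2) (p.1 - y) (u p.2 y) (v p.2 y)) hF.stronglyMeasurable

/-! ### The weighted estimates -/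

/-- **Kato's `L³` and `L⁶` estimates for `B(u, v)`** (Kato 1984, (2.3)–(2.4); Lemarié-Rieusset
2016, proof of Thm. 7.5, PDF pp. 156–157, `q = 6`, `β = 1/4`). In dimension three there is
`K = K(E) > 0` such that: if `u`, `v` are jointly strongly measurable and
`‖|u(s)||v(s)|‖_{L³} ≤ m s^{-1/2}` for `s ∈ (0, T)` (e.g. `s^{1/4}‖u(s)‖₆`, `s^{1/4}‖v(s)‖₆`
bounded, `eLpNorm_norm_mul_norm_three_le`), then for every `t ∈ (0, T]`
`‖B(u,v)(t)‖_{L³} ≤ K m` and `‖B(u,v)(t)‖_{L⁶} ≤ K m t^{-1/4}`. Proof: Minkowski's integral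
inequality for `B(t) = ∫_{(0,t)} T_{t-s}[u(s),v(s)] ds` with the slice bounds
`‖T_σ‖_{3→3} ≤ C σ^{-1/2}`, `‖T_σ‖_{3→6} ≤ C σ^{-3/4}` (`OseenKernelLp.lean`) and the time
integrals `∫₀ᵗ (t-s)^{-1/2}s^{-1/2} ≤ 8`, `∫₀ᵗ (t-s)^{-3/4}s^{-1/2} ≤ 12 t^{-1/4}`. [cite: LemarieRieusset2016, Thm. 7.5 (proof, PDF pp. 156–157)] -/
theorem exists_eLpNorm_kochTataruBilinear_le (hE : Module.finrank ℝ E = 3) :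
    ∃ K : ℝ, 0 < K ∧ ∀ {u v : ℝ → E → E}, StronglyMeasurable (uncurry u) →
      StronglyMeasurable (uncurry v) → ∀ {T m : ℝ}, 0 ≤ m →
      (∀ s ∈ Ioo 0 T, eLpNorm (fun y => ‖u s y‖ * ‖v s y‖) 3 volume ≤
        ENNReal.ofReal (m * s ^ (-(1 / 2 : ℝ)))) →
      ∀ t ∈ Ioc 0 T,
        eLpNorm (kochTataruBilinear u v t) 3 volume ≤ ENNReal.ofReal (K * m) ∧
          eLpNorm (kochTataruBilinear u v t) 6 volume ≤
            ENNReal.ofReal (K * m * t ^ (-(1 / 4 : ℝ))) := by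
  -- the two slice constants
  obtain ⟨C₀, hC₀, hK⟩ := exists_norm_oseenKernel_le (E := E)
  set M₁ : ℝ := ∫ w : E, (1 + ‖w‖ ^ 2) ^ (-(((Module.finrank ℝ E : ℝ) + 1) / 2)) with hM₁
  have hM₁0 : 0 < M₁ := integral_one_add_norm_sq_rpow_neg_pos (by linarith)
  obtain ⟨C₆, hC₆, h36⟩ := exists_eLpNorm_oseenSlice_le (E := E) (p := 3) (q := 6)
    (by norm_num) (by norm_num) (by norm_num)
  have hd : (Module.finrank ℝ E : ℝ) = 3 := by exact_mod_cast hE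
  -- the exponent of the `3 → 6` bound is `-3/4`
  have hexp : -(1 / 2 : ℝ) - (Module.finrank ℝ E : ℝ) / 2 * (1 / (3 : ℝ≥0∞).toReal -
      1 / (6 : ℝ≥0∞).toReal) = -(3 / 4 : ℝ) := by
    rw [hd]; norm_num
  refine ⟨(C₀ * M₁ + C₆ + 1) * 16, by positivity, fun {u v} hu hv {T m} hm hf t ht => ?_⟩
  have ht0 : 0 < t := ht.1
  -- Minkowski for `B(t) = ∫_{(0,t)} T_{t-s}[u s, v s] ds`
  set F : E → ℝ → E := fun x s => ∫ y, oseenKernel (t - s) (x - y) (u s y) (v s y) with hF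
  have hFm : AEStronglyMeasurable (uncurry F)
      ((volume : Measure E).prod (volume.restrict (Ioo 0 t))) :=
    (stronglyMeasurable_slice_prod hu hv t).aestronglyMeasurable
  have hB : kochTataruBilinear u v t = fun x => ∫ s in Ioo 0 t, F x s := rfl
  have hus : ∀ s, AEStronglyMeasurable (u s) volume := fun s =>
    (hu.comp_measurable (measurable_const.prodMk measurable_id)).aestronglyMeasurable
  have hvs : ∀ s, AEStronglyMeasurable (v s) volume := fun s =>
    (hv.comp_measurable (measurable_const.prodMk measurable_id)).aestronglyMeasurable
  have hmink : ∀ {q : ℝ≥0∞}, 1 ≤ q → q ≠ ∞ →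
      eLpNorm (kochTataruBilinear u v t) q volume ≤
        ∫⁻ s in Ioo 0 t, eLpNorm (fun x => F x s) q volume := fun hq1 hq =>
    hB ▸ FunctionSpaces.eLpNorm_integral_le_lintegral_eLpNorm hFm hq1 hq
  constructor
  · -- `L³`
    refine (hmink (by norm_num) (by norm_num)).trans ?_
    have hsl : ∀ s ∈ Ioo 0 t, eLpNorm (fun x => F x s) 3 volume ≤
        ENNReal.ofReal (C₀ * M₁ * m) * ENNReal.ofReal ((t - s) ^ (-(1 / 2 : ℝ)) * s ^ (-(1 / 2 : ℝ))) := by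
      intro s hs
      have hσ : 0 < t - s := sub_pos.2 hs.2
      have hsT : s ∈ Ioo 0 T := ⟨hs.1, hs.2.trans_le ht.2⟩
      refine (eLpNorm_oseenSlice_le_same hC₀.le hK hσ (hus s) (hvs s) (by norm_num)).trans ?_
      refine (mul_le_mul' le_rfl (hf s hsT)).trans (le_of_eq ?_)
      rw [← hM₁, ← ENNReal.ofReal_mul (by positivity), ← ENNReal.ofReal_mul (by positivity)]
      congr 1
      ring
    calc ∫⁻ s in Ioo 0 t, eLpNorm (fun x => F x s) 3 volume
        ≤ ∫⁻ s in Ioo 0 t, ENNReal.ofReal (C₀ * M₁ * m) *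
            ENNReal.ofReal ((t - s) ^ (-(1 / 2 : ℝ)) * s ^ (-(1 / 2 : ℝ))) :=
          setLIntegral_mono' measurableSet_Ioo fun s hs => hsl s hs
      _ = ENNReal.ofReal (C₀ * M₁ * m) *
            ∫⁻ s in Ioo 0 t, ENNReal.ofReal ((t - s) ^ (-(1 / 2 : ℝ)) * s ^ (-(1 / 2 : ℝ))) :=
          lintegral_const_mul' _ _ ENNReal.ofReal_ne_top
      _ ≤ ENNReal.ofReal (C₀ * M₁ * m) *
            ENNReal.ofReal (2 * (1 / (1 - 1 / 2) + 1 / (1 - 1 / 2)) * t ^ (1 - 1 / 2 - 1 / 2 : ℝ)) :=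
          mul_le_mul' le_rfl (lintegral_Ioo_rpow_mul_rpow_le (by norm_num) (by norm_num)
            (by norm_num) (by norm_num) ht0)
      _ ≤ ENNReal.ofReal ((C₀ * M₁ + C₆ + 1) * 16 * m) := by
          rw [← ENNReal.ofReal_mul (by positivity)]
          refine ENNReal.ofReal_le_ofReal ?_
          norm_num
          nlinarith [hC₀, hM₁0, hC₆, hm, mul_nonneg (mul_nonneg hC₀.le hM₁0.le) hm]
  · -- `L⁶`
    refine (hmink (by norm_num) (by norm_num)).trans ?_
    have hsl : ∀ s ∈ Ioo 0 t, eLpNorm (fun x => F x s) 6 volume ≤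
        ENNReal.ofReal (C₆ * m) * ENNReal.ofReal ((t - s) ^ (-(3 / 4 : ℝ)) * s ^ (-(1 / 2 : ℝ))) := by
      intro s hs
      have hσ : 0 < t - s := sub_pos.2 hs.2
      have hsT : s ∈ Ioo 0 T := ⟨hs.1, hs.2.trans_le ht.2⟩
      have h := h36 hσ (hus s) (hvs s)
      rw [hexp] at h
      refine h.trans ?_
      refine (mul_le_mul' le_rfl (hf s hsT)).trans (le_of_eq ?_)
      rw [← ENNReal.ofReal_mul (by positivity), ← ENNReal.ofReal_mul (by positivity)]
      congr 1
      ring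
    calc ∫⁻ s in Ioo 0 t, eLpNorm (fun x => F x s) 6 volume
        ≤ ∫⁻ s in Ioo 0 t, ENNReal.ofReal (C₆ * m) *
            ENNReal.ofReal ((t - s) ^ (-(3 / 4 : ℝ)) * s ^ (-(1 / 2 : ℝ))) :=
          setLIntegral_mono' measurableSet_Ioo fun s hs => hsl s hs
      _ = ENNReal.ofReal (C₆ * m) *
            ∫⁻ s in Ioo 0 t, ENNReal.ofReal ((t - s) ^ (-(3 / 4 : ℝ)) * s ^ (-(1 / 2 : ℝ))) :=
          lintegral_const_mul' _ _ ENNReal.ofReal_ne_top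
      _ ≤ ENNReal.ofReal (C₆ * m) *
            ENNReal.ofReal (2 * (1 / (1 - 3 / 4) + 1 / (1 - 1 / 2)) * t ^ (1 - 3 / 4 - 1 / 2 : ℝ)) :=
          mul_le_mul' le_rfl (lintegral_Ioo_rpow_mul_rpow_le (by norm_num) (by norm_num)
            (by norm_num) (by norm_num) ht0)
      _ ≤ ENNReal.ofReal ((C₀ * M₁ + C₆ + 1) * 16 * m * t ^ (-(1 / 4 : ℝ))) := by
          rw [← ENNReal.ofReal_mul (by positivity)]
          refine ENNReal.ofReal_le_ofReal ?_
          have hτ : (0 : ℝ) ≤ t ^ (-(1 / 4 : ℝ)) := Real.rpow_nonneg ht0.le _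
          have he : (1 - 3 / 4 - 1 / 2 : ℝ) = -(1 / 4 : ℝ) := by norm_num
          rw [he]
          norm_num
          nlinarith [hC₀, hM₁0, hC₆, hm, mul_nonneg hC₆ hm, mul_nonneg (mul_nonneg hC₆ hm) hτ,
            mul_nonneg (mul_nonneg (mul_nonneg hC₀.le hM₁0.le) hm) hτ, mul_nonneg hm hτ]

/-- **Kato's pointwise (`L^∞`) estimate for `B(u, v)` and absolute convergence** (Kato 1984,
(2.5); Lemarié-Rieusset 2016, proof of Thm. 15.1 (A), PDF p. 565: "`√t u` is bounded"). In
dimension three there is `K = K(E) > 0` such that: if `u`, `v` are jointly strongly measurable and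
`‖|u(s)||v(s)|‖_{L⁶} ≤ m s^{-3/4}` for `s ∈ (0, T)` (e.g. `s^{1/4}‖u‖₆` and `s^{1/2}‖v‖_∞`
bounded, `eLpNorm_norm_mul_norm_six_le_of_right`), then for every `t ∈ (0, T]` and **every**
`x`, the space–time integrand `(s, y) ↦ K(t-s, x-y)[u(s,y), v(s,y)]` is integrable on
`(0, t) × E` and `‖B(u,v)(t,x)‖ ≤ K m t^{-1/2}`. Proof: the pointwise Hölder bound
`∫ ‖K(σ, x-y)[u,v]‖ dy ≤ C₀ ‖Env_σ‖_{6/5} ‖|u||v|‖₆ ≤ C σ^{-3/4} m s^{-3/4}` and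
`∫₀ᵗ (t-s)^{-3/4} s^{-3/4} ds ≤ 16 t^{-1/2}` (Tonelli). [cite: LemarieRieusset2016, Thm. 15.1 (A), proof (PDF p. 565)] -/
theorem exists_norm_kochTataruBilinear_le (hE : Module.finrank ℝ E = 3) :
    ∃ K : ℝ, 0 < K ∧ ∀ {u v : ℝ → E → E}, StronglyMeasurable (uncurry u) →
      StronglyMeasurable (uncurry v) → ∀ {T m : ℝ}, 0 ≤ m →
      (∀ s ∈ Ioo 0 T, eLpNorm (fun y => ‖u s y‖ * ‖v s y‖) 6 volume ≤
        ENNReal.ofReal (m * s ^ (-(3 / 4 : ℝ)))) →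
      ∀ t ∈ Ioc 0 T, ∀ x : E,
        Integrable (fun p : ℝ × E => oseenKernel (t - p.1) (x - p.2) (u p.1 p.2) (v p.1 p.2))
            ((volume : Measure (ℝ × E)).restrict (Ioo 0 t ×ˢ univ)) ∧
          ‖kochTataruBilinear u v t x‖ ≤ K * m * t ^ (-(1 / 2 : ℝ)) := by
  obtain ⟨C₀, hC₀, hK⟩ := exists_norm_oseenKernel_le (E := E)
  haveI : ENNReal.HolderTriple (6 / 5 : ℝ≥0∞) 6 1 := holderTriple_sixFifths_six_one
  have h65 : (1 : ℝ≥0∞) ≤ 6 / 5 := by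
    rw [ENNReal.le_div_iff_mul_le (Or.inl (by norm_num)) (Or.inl (by norm_num))]
    norm_num
  have h65top : (6 / 5 : ℝ≥0∞) ≠ ∞ := ENNReal.div_ne_top (by norm_num) (by norm_num)
  obtain ⟨Cr, hCr, hEnv⟩ := exists_eLpNorm_oseenEnvelope_le (E := E) hC₀.le (r := (6 / 5 : ℝ≥0∞))
    h65 h65top
  have hd : (Module.finrank ℝ E : ℝ) = 3 := by exact_mod_cast hE
  have hexp : (Module.finrank ℝ E : ℝ) / (2 * ((6 / 5 : ℝ≥0∞)).toReal) -
      ((Module.finrank ℝ E : ℝ) + 1) / 2 = -(3 / 4 : ℝ) := by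
    rw [hd, ENNReal.toReal_div]; norm_num
  refine ⟨(Cr + 1) * 16, by positivity, fun {u v} hu hv {T m} hm hf t ht x => ?_⟩
  have ht0 : 0 < t := ht.1
  have hus : ∀ s, AEStronglyMeasurable (u s) volume := fun s =>
    (hu.comp_measurable (measurable_const.prodMk measurable_id)).aestronglyMeasurable
  have hvs : ∀ s, AEStronglyMeasurable (v s) volume := fun s =>
    (hv.comp_measurable (measurable_const.prodMk measurable_id)).aestronglyMeasurable
  -- the `y`-integral of the norm of the integrand at fixed `s`: Hölder `6/5 × 6` on the majorant
  have hslice : ∀ s ∈ Ioo 0 t, ∫⁻ y, ‖oseenKernel (t - s) (x - y) (u s y) (v s y)‖ₑ ≤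
      ENNReal.ofReal (Cr * m) * ENNReal.ofReal ((t - s) ^ (-(3 / 4 : ℝ)) * s ^ (-(3 / 4 : ℝ))) := by
    intro s hs
    have hσ : 0 < t - s := sub_pos.2 hs.2
    have hsT : s ∈ Ioo 0 T := ⟨hs.1, hs.2.trans_le ht.2⟩
    set Env : E → ℝ := fun z => C₀ * ((t - s) + ‖z‖ ^ 2) ^
      (-(((Module.finrank ℝ E : ℝ) + 1) / 2)) with hEnv_def
    set g : E → ℝ := fun y => ‖u s y‖ * ‖v s y‖ with hg_def
    have hEnvm : AEStronglyMeasurable Env volume :=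
      (measurable_const.mul ((measurable_const.add (measurable_norm.pow_const 2)).pow
        measurable_const)).aestronglyMeasurable
    have hgm : AEStronglyMeasurable g volume := (hus s).norm.mul (hvs s).norm
    have hEnv0 : ∀ z, 0 ≤ Env z := fun z => mul_nonneg hC₀.le (Real.rpow_nonneg (by positivity) _)
    have hpt : ∀ y, ‖oseenKernel (t - s) (x - y) (u s y) (v s y)‖ₑ ≤ ‖Env (x - y)‖ₑ * ‖g y‖ₑ := by
      intro y
      have h := hK hσ (x - y) (u s y) (v s y)
      rw [← ofReal_norm, Real.enorm_eq_ofReal (hEnv0 _),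
        Real.enorm_eq_ofReal (mul_nonneg (norm_nonneg _) (norm_nonneg _)),
        ← ENNReal.ofReal_mul (hEnv0 _)]
      refine ENNReal.ofReal_le_ofReal ?_
      calc ‖oseenKernel (t - s) (x - y) (u s y) (v s y)‖
          ≤ C₀ * ((t - s) + ‖x - y‖ ^ 2) ^ (-(((Module.finrank ℝ E : ℝ) + 1) / 2)) *
              ‖u s y‖ * ‖v s y‖ := h
        _ = Env (x - y) * g y := by simp only [hEnv_def, hg_def]; ring
    have hrefl : ∫⁻ y, ‖Env (x - y)‖ₑ * ‖g y‖ₑ = ∫⁻ y, ‖Env y‖ₑ * ‖g (x - y)‖ₑ := by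
      have h := lintegral_sub_left_eq_self (μ := (volume : Measure E))
        (fun y => ‖Env y‖ₑ * ‖g (x - y)‖ₑ) x
      simp only [sub_sub_cancel] at h
      exact h
    have hEnv' : eLpNorm Env (6 / 5 : ℝ≥0∞) volume ≤
        ENNReal.ofReal (Cr * (t - s) ^ (-(3 / 4 : ℝ))) := by
      have h := hEnv _ hσ
      rwa [hexp] at h
    calc ∫⁻ y, ‖oseenKernel (t - s) (x - y) (u s y) (v s y)‖ₑ
        ≤ ∫⁻ y, ‖Env (x - y)‖ₑ * ‖g y‖ₑ := lintegral_mono hpt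
      _ = ∫⁻ y, ‖Env y‖ₑ * ‖g (x - y)‖ₑ := hrefl
      _ = eLpNorm (Env • fun y => g (x - y)) 1 volume := by
          rw [eLpNorm_one_eq_lintegral_enorm]
          simp_rw [Pi.smul_apply', smul_eq_mul, enorm_mul]
      _ ≤ eLpNorm Env (6 / 5 : ℝ≥0∞) volume * eLpNorm (fun y => g (x - y)) 6 volume :=
          eLpNorm_smul_le_mul_eLpNorm
            (hgm.comp_measurePreserving (Measure.measurePreserving_sub_left volume x)) hEnvm
      _ = eLpNorm Env (6 / 5 : ℝ≥0∞) volume * eLpNorm g 6 volume := by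
          rw [show (fun y => g (x - y)) = g ∘ (fun y => x - y) from rfl,
            eLpNorm_comp_measurePreserving hgm (Measure.measurePreserving_sub_left volume x)]
      _ ≤ ENNReal.ofReal (Cr * (t - s) ^ (-(3 / 4 : ℝ))) * ENNReal.ofReal (m * s ^ (-(3 / 4 : ℝ))) :=
          mul_le_mul' hEnv' (hf s hsT)
      _ = ENNReal.ofReal (Cr * m) * ENNReal.ofReal ((t - s) ^ (-(3 / 4 : ℝ)) * s ^ (-(3 / 4 : ℝ))) := by
          rw [← ENNReal.ofReal_mul (by positivity), ← ENNReal.ofReal_mul (by positivity)]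
          congr 1
          ring
  -- measurability of the space–time integrand
  have hmeas : AEStronglyMeasurable
      (fun p : ℝ × E => oseenKernel (t - p.1) (x - p.2) (u p.1 p.2) (v p.1 p.2))
      ((volume : Measure (ℝ × E)).restrict (Ioo 0 t ×ˢ univ)) :=
    aestronglyMeasurable_oseenKernel_duhamel
      (hu.aestronglyMeasurable.mono_measure Measure.restrict_le_self)
      (hv.aestronglyMeasurable.mono_measure Measure.restrict_le_self) t x
  -- the space–time lintegral is finite
  have htime := lintegral_Ioo_rpow_mul_rpow_le (α := 3 / 4) (β := 3 / 4) (by norm_num) (by norm_num)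
    (by norm_num) (by norm_num) ht0
  have htot : ∫⁻ p in Ioo 0 t ×ˢ univ, ‖oseenKernel (t - p.1) (x - p.2) (u p.1 p.2) (v p.1 p.2)‖ₑ ≤
      ENNReal.ofReal (Cr * m) * ENNReal.ofReal (2 * (1 / (1 - 3 / 4) + 1 / (1 - 3 / 4)) *
        t ^ (1 - 3 / 4 - 3 / 4 : ℝ)) := by
    rw [volume_restrict_prod_univ_eq_prod, lintegral_prod _ (by
      have h := hmeas.enorm
      rwa [volume_restrict_prod_univ_eq_prod] at h)]
    calc ∫⁻ s in Ioo 0 t, ∫⁻ y, ‖oseenKernel (t - s) (x - y) (u s y) (v s y)‖ₑ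
        ≤ ∫⁻ s in Ioo 0 t, ENNReal.ofReal (Cr * m) *
            ENNReal.ofReal ((t - s) ^ (-(3 / 4 : ℝ)) * s ^ (-(3 / 4 : ℝ))) :=
          setLIntegral_mono' measurableSet_Ioo fun s hs => hslice s hs
      _ = ENNReal.ofReal (Cr * m) *
            ∫⁻ s in Ioo 0 t, ENNReal.ofReal ((t - s) ^ (-(3 / 4 : ℝ)) * s ^ (-(3 / 4 : ℝ))) :=
          lintegral_const_mul' _ _ ENNReal.ofReal_ne_top
      _ ≤ _ := mul_le_mul' le_rfl htime
  have hint : Integrable (fun p : ℝ × E => oseenKernel (t - p.1) (x - p.2) (u p.1 p.2) (v p.1 p.2))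
      ((volume : Measure (ℝ × E)).restrict (Ioo 0 t ×ˢ univ)) :=
    ⟨hmeas, htot.trans_lt (ENNReal.mul_lt_top ENNReal.ofReal_lt_top ENNReal.ofReal_lt_top)⟩
  refine ⟨hint, ?_⟩
  -- the norm of `B(t, x)` is at most the space–time lintegral
  have hB : ‖kochTataruBilinear u v t x‖ₑ ≤
      ∫⁻ p in Ioo 0 t ×ˢ univ, ‖oseenKernel (t - p.1) (x - p.2) (u p.1 p.2) (v p.1 p.2)‖ₑ := by
    unfold kochTataruBilinear
    have hint' := hint
    rw [volume_restrict_prod_univ_eq_prod] at hint' ⊢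
    rw [← integral_prod _ hint']
    exact enorm_integral_le_lintegral_enorm _
  have he : (1 - 3 / 4 - 3 / 4 : ℝ) = -(1 / 2 : ℝ) := by norm_num
  rw [he] at htot
  have hfinal : ‖kochTataruBilinear u v t x‖ₑ ≤ ENNReal.ofReal ((Cr + 1) * 16 * m * t ^ (-(1 / 2 : ℝ))) := by
    refine (hB.trans htot).trans ?_
    rw [← ENNReal.ofReal_mul (by positivity)]
    refine ENNReal.ofReal_le_ofReal ?_
    have hτ : (0 : ℝ) ≤ t ^ (-(1 / 2 : ℝ)) := Real.rpow_nonneg ht0.le _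
    norm_num
    nlinarith [hCr, hm, mul_nonneg hCr hm, mul_nonneg (mul_nonneg hCr hm) hτ, mul_nonneg hm hτ]
  rw [← ofReal_norm] at hfinal
  exact (ENNReal.ofReal_le_ofReal_iff (by positivity)).1 hfinal

end KatoL3

end Literature.Analysis.FluidPDE
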